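import Literature.Analysis.FluidPDE.PassiveScalarForced
import Literature.Analysis.FluidPDE.PassiveScalarEnergyPointwise
import Summits.AnomalousDissipation.AnomalousDissipation.Theses.LimitingAbsorption
import Summits.AnomalousDissipation.AnomalousDissipation.Theorems.RelaxingFamily.Negative.LinearEnstrophyBudget
import HarnessLib

/-!
# Negative knowledge for the crux `UniformRelaxationWitness` (stmt-AnomalousDissipation-2937), I:
# the profile of a witness is nonzero, so every Seis floor of `RelaxingFamily` binds the crux

Refuter (cdisprove) lemmas for
`Summit.AnomalousDissipation.AnomalousDissipation.Theses.LimitingAbsorption.UniformRelaxationWitness`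
(route `route-AnomalousDissipation-LimitingAbsorption`, crux r2 = thesis X; supports
stmt-AnomalousDissipation-2937). All statements are NEGATIVE (no Theses decl is concluded positively).

* `longTimeAvgSup_dissipation_eq_zero_of_zero_source` — **the absorbed-power floor (ABS) sees the
  source**: for `κ > 0` and a drift essentially bounded on every `(0,T) × T²`, EVERY global weak
  solution of `∂ₜθ + u·∇θ = κΔθ + 0` from datum `0` has `⟨κ‖∇θ‖²⟩ = longTimeAvgSup (κ‖∇θ(t)‖²) = 0`
  (pointwise energy inequality for bounded drift, `lintegral_sq_add_le_holds`, kills the cumulative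
  dissipation on every horizon; the Cesàro means then vanish, junk conventions included).
* `UniformRelaxationWitnessUnder Hyp` — the crux VERBATIM with one extra hypothesis `Hyp g h ν v` on the
  witness (`uniformRelaxationWitnessUnder_true_iff`: with `Hyp := ⊤` it is the crux), the shape shared
  with `RelaxingFamily.Negative.RelaxingFamilyUnder`.
* `UniformRelaxationWitnessUnder.relaxingFamilyUnder` — **a witness of X has `h ≠ 0`** (by the first
  lemma the (ABS) clause fails for `h = 0` at every level), hence is a witness of `RelaxingFamilyUnder`
  with the same extra hypothesis: the crux inherits every refuted strengthening of `RelaxingFamily`.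
* Corollaries (all UNCONDITIONAL): `uniformRelaxationWitness_false_of_not_relaxingFamily`
  (`¬ RelaxingFamily → ¬ UniformRelaxationWitness`: a refutation of crux r3 kills r2),
  `uniformRelaxationWitness_false_with_zero_profile`,
  `uniformRelaxationWitness_false_without_superlinearEnstrophy` (Seis' floor: no witness admits a
  `j`-uniform linear windowed budget `∫₀ᵗ‖∇v_j(s_j+τ)‖₂ dτ ≤ M(1+t)` from some phase on),
  `uniformRelaxationWitness_false_without_unboundedEnstrophy`,
  `uniformRelaxationWitness_false_without_superlinearMeanEnstrophy` (no `j`-uniform quadratic budget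
  `∫₀ᵗ‖∇v_j(s_j+τ)‖₂² ≤ Z(1+t)`: the receptacle of time-averaged enstrophy bounds — single-shell
  forcing by the ShellPincer bound, band-limited / Galerkin / laminar / condensate stirring, no stirring).

## References

* C. Seis, Comm. Math. Phys. 399 (2023) 2071–2081 = arXiv:2003.08794, Thm. 2, Rmk. 1. [`Seis2022`]
* T. Drivas, T. Elgindi, G. Iyer, I.-J. Jeong, ARMA 243 (2022), (1.3) (scalar energy balance). [`DEIJ2022`]
-/

noncomputable section

open MeasureTheory Set Filter Function TopologicalSpace Topology
open scoped ENNReal NNReal InnerProductSpace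

namespace Summit.AnomalousDissipation.AnomalousDissipation.Theorems.UniformRelaxationWitness.Negative

-- D-0017: single-problem summit ⇒ `Summit.AnomalousDissipation.AnomalousDissipation.…` by design.
set_option linter.dupNamespace false

open Literature.Analysis.FunctionSpaces Literature.Analysis.FunctionSpaces.Torus
open Literature.Analysis.FluidPDE Literature.Analysis.FluidPDE.Torus
open Summit.AnomalousDissipation.AnomalousDissipation.Theses.LimitingAbsorption
open Summit.AnomalousDissipation.AnomalousDissipation.Theorems.RelaxingFamily.Negative

/-- The unit flat 2-torus (local notation). -/
local notation "𝕋²" => UnitAddTorus (Fin 2)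
/-- Planar vectors (local notation). -/
local notation "E²" => EuclideanSpace ℝ (Fin 2)

/-! ## (ABS) sees the source: zero source and zero datum give zero mean dissipation -/

/-- An a.e. statement on a nondegenerate interval `(a, b)` has a witness in `(a, b)`. [folklore] -/
theorem exists_of_ae_Ioo {P : ℝ → Prop} {a b : ℝ} (hab : a < b)
    (h : ∀ᵐ t ∂(volume.restrict (Ioo a b)), P t) : ∃ t ∈ Ioo a b, P t := by
  have hne : (ae (volume.restrict (Ioo a b))).NeBot := by
    rw [ae_neBot, Ne, Measure.restrict_eq_zero, Real.volume_Ioo, ENNReal.ofReal_eq_zero, not_le]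
    linarith
  obtain ⟨t, ht, hP⟩ := ((ae_restrict_mem measurableSet_Ioo).and h).exists
  exact ⟨t, ht, hP⟩

/-- **Zero source, zero datum ⇒ zero cumulative dissipation on every horizon** (bounded drift,
`κ > 0`): the pointwise energy inequality `‖θ(t)‖² + 2κ∫₀ᵗ‖∇θ‖² ≤ ‖θ₀‖² = 0` at a good time
`t ∈ (T, T+1)`. [cite: DEIJ2022, (1.3)] -/
theorem lintegral_eScalarGradNormSq_eq_zero_of_zero_source {κ : ℝ} (hκ : 0 < κ)
    {u : ℝ → 𝕋² → E²}
    (hu : ∀ T : ℝ, 0 < T → MemLp (stLift u) ⊤ (volume.restrict (Ioo (0 : ℝ) T ×ˢ univ)))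
    {θ : ℝ → 𝕋² → ℝ} (hθ : IsWeakScalarTransportForced κ u (fun _ => 0) 0 θ) {T : ℝ} (hT : 0 < T) :
    ∫⁻ τ in Ioo 0 T, eScalarGradNormSq (θ τ) = 0 := by
  have hsol : IsWeakScalarTransportOn (T + 1) κ u 0 θ :=
    isWeakScalarTransportForcedOn_zero_iff.1 (hθ (T + 1) (by linarith))
  have hE := IsWeakScalarTransportOn.lintegral_sq_add_le_holds hκ hsol MemLp.zero
    (hu (T + 1) (by linarith))
  have hE' := ae_restrict_of_ae_restrict_of_subset (Ioo_subset_Ioo_left hT.le : Ioo T (T + 1) ⊆ _) hE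
  obtain ⟨t, ht, hle⟩ := exists_of_ae_Ioo (by linarith) hE'
  have hrhs : ∫⁻ x, ‖(0 : 𝕋² → ℝ) x‖ₑ ^ 2 = 0 := by simp
  have h2 : 2 * eScalarDissipation κ θ 0 t = 0 :=
    le_antisymm (le_add_self.trans (hle.trans hrhs.le)) zero_le
  have h3 : ∫⁻ τ in Ioo 0 t, eScalarGradNormSq (θ τ) = 0 := by
    unfold eScalarDissipation at h2
    rcases mul_eq_zero.1 h2 with h | h
    · exact absurd h two_ne_zero
    rcases mul_eq_zero.1 h with h' | h'
    · exact absurd h' (by rw [ENNReal.ofReal_eq_zero, not_le]; exact hκ)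
    · exact h'
  refine le_antisymm ?_ zero_le
  calc ∫⁻ τ in Ioo 0 T, eScalarGradNormSq (θ τ)
      ≤ ∫⁻ τ in Ioo 0 t, eScalarGradNormSq (θ τ) := lintegral_mono_set (Ioo_subset_Ioo_right ht.1.le)
    _ = 0 := h3

/-- **(ABS) sees the source.** For `κ > 0` and a drift `u` essentially bounded on every
`(0,T) × T²`, every global weak solution of `∂ₜθ + u·∇θ = κΔθ` with ZERO source from ZERO datum
has vanishing mean dissipation `longTimeAvgSup (t ↦ κ‖∇θ(t)‖²) = 0` (all Cesàro means vanish: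
the cumulative spectral dissipation is `0` on every horizon, and a nonnegative function below an
a.e.-null `ℝ≥0∞` function has Bochner integral `0`, measurable or not). Hence the absorbed-power
clause of the crux fails at every level when the profile is `h = 0`. [cite: DEIJ2022, (1.3)] -/
theorem longTimeAvgSup_dissipation_eq_zero_of_zero_source {κ : ℝ} (hκ : 0 < κ)
    {u : ℝ → 𝕋² → E²}
    (hu : ∀ T : ℝ, 0 < T → MemLp (stLift u) ⊤ (volume.restrict (Ioo (0 : ℝ) T ×ˢ univ)))
    {θ : ℝ → 𝕋² → ℝ} (hθ : IsWeakScalarTransportForced κ u (fun _ => 0) 0 θ) :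
    longTimeAvgSup (fun t => κ * (eScalarGradNormSq (θ t)).toReal) = 0 := by
  -- the Cesàro means vanish for `T > 0`
  have hmean : ∀ T : ℝ, 0 < T → timeMean (fun t => κ * (eScalarGradNormSq (θ t)).toReal) T = 0 := by
    intro T hT
    set F : ℝ → ℝ := fun t => (eScalarGradNormSq (θ t)).toReal with hF
    have hI : ∫ t in Ioc 0 T, F t = 0 := by
      have hFnn : 0 ≤ᵐ[volume.restrict (Ioc 0 T)] F :=
        Eventually.of_forall fun t => ENNReal.toReal_nonneg
      have hlin : ∫⁻ t in Ioc 0 T, ENNReal.ofReal (F t) = 0 := by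
        refine le_antisymm ?_ zero_le
        calc ∫⁻ t in Ioc 0 T, ENNReal.ofReal (F t)
            ≤ ∫⁻ t in Ioc 0 T, eScalarGradNormSq (θ t) :=
              lintegral_mono fun t => ENNReal.ofReal_toReal_le
          _ ≤ ∫⁻ t in Ioo 0 (T + 1), eScalarGradNormSq (θ t) :=
              lintegral_mono_set (Ioc_subset_Ioo_right (by linarith))
          _ = 0 := lintegral_eScalarGradNormSq_eq_zero_of_zero_source hκ hu hθ (by linarith)
      by_cases hFm : AEStronglyMeasurable F (volume.restrict (Ioc 0 T))
      · rw [integral_eq_lintegral_of_nonneg_ae hFnn hFm, hlin, ENNReal.toReal_zero]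
      · exact integral_non_aestronglyMeasurable hFm
    unfold timeMean
    rw [intervalIntegral.integral_of_le hT.le, integral_const_mul]
    change T⁻¹ * (κ * ∫ t in Ioc 0 T, F t) = 0
    rw [hI, mul_zero, mul_zero]
  -- hence the `limsup` is that of the zero function
  unfold longTimeAvgSup
  have hev : timeMean (fun t => κ * (eScalarGradNormSq (θ t)).toReal) =ᶠ[atTop] fun _ => (0 : ℝ) :=
    (eventually_gt_atTop 0).mono fun T hT => hmean T hT
  rw [Filter.limsup_congr hev, Filter.limsup_const]

/-! ## The crux with an extra hypothesis on the witness -/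

/-- The crux `UniformRelaxationWitness` (thesis X) with an EXTRA hypothesis `Hyp g h ν v` on the
witness — the shape of refuted strengthenings, parallel to `RelaxingFamily.Negative.RelaxingFamilyUnder`
(`¬ UniformRelaxationWitnessUnder Hyp` reads "any witness of X leaves the class `Hyp`"). -/
def UniformRelaxationWitnessUnder
    (Hyp : (𝕋² → E²) → (𝕋² → ℝ) → (ℕ → ℝ) → (ℕ → ℝ → 𝕋² → E²) → Prop) : Prop :=
  ∃ (g : 𝕋² → E²) (h : 𝕋² → ℝ), IsSmooth g ∧ IsDivFree g ∧ HasZeroMean g ∧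
    IsSmooth h ∧ HasZeroMean h ∧
    ∃ (ν : ℕ → ℝ) (v₀ : ℕ → 𝕋² → E²) (v : ℕ → ℝ → 𝕋² → E²),
      (∀ j, 0 < ν j) ∧ Tendsto ν atTop (𝓝 0) ∧
      (∀ j, IsGlobalLerayHopf (ν j) (fun _ => g) (v₀ j) (v j)) ∧
      (∀ j (T : ℝ), 0 < T →
        MemLp (stLift (v j)) ⊤ (volume.restrict (Ioo (0 : ℝ) T ×ˢ univ))) ∧
      (∃ E : ℝ, ∀ j, meanEnergy (v j) ≤ E) ∧
      Hyp g h ν v ∧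
      (∃ C γ : ℝ, 0 ≤ C ∧ 0 < γ ∧ RelaxesUniformly ν v h C γ) ∧
      ∃ ε : ℝ, 0 < ε ∧ ∀ j : ℕ, ∃ θ : ℝ → 𝕋² → ℝ,
        IsWeakScalarTransportForced (ν j) (v j) (fun _ => h) 0 θ ∧
        ε ≤ longTimeAvgSup (fun t => ν j * (eScalarGradNormSq (θ t)).toReal)

/-- Sanity: with the trivial extra hypothesis `UniformRelaxationWitnessUnder` is the crux itself. [folklore] -/
theorem uniformRelaxationWitnessUnder_true_iff :
    UniformRelaxationWitnessUnder (fun _ _ _ _ => True) ↔ UniformRelaxationWitness := by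
  unfold UniformRelaxationWitnessUnder RelaxesUniformly UniformRelaxationWitness
  simp only [true_and]

/-- Monotonicity of `UniformRelaxationWitnessUnder` in the extra hypothesis. [folklore] -/
theorem UniformRelaxationWitnessUnder.mono
    {H₁ H₂ : (𝕋² → E²) → (𝕋² → ℝ) → (ℕ → ℝ) → (ℕ → ℝ → 𝕋² → E²) → Prop}
    (h12 : ∀ g h ν v, H₁ g h ν v → H₂ g h ν v) (h1 : UniformRelaxationWitnessUnder H₁) :
    UniformRelaxationWitnessUnder H₂ := by
  obtain ⟨g, h, hg, hgd, hgm, hh, hhm, ν, v₀, v, hν, hνlim, hLH, hbd, hE, hH, hrest⟩ := h1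
  exact ⟨g, h, hg, hgd, hgm, hh, hhm, ν, v₀, v, hν, hνlim, hLH, hbd, hE, h12 _ _ _ _ hH, hrest⟩

/-! ## The profile of a witness is nonzero: X-witnesses are `RelaxingFamily`-witnesses -/

/-- **A witness of X has `h ≠ 0` and is a witness of `RelaxingFamilyUnder` with the same extra
hypothesis.** If `h = 0`, the (ABS) clause at level `0` asks for `ε ≤ ⟨ν₀‖∇θ‖²⟩` along a global
weak solution with zero source and zero datum into the bounded drift `v₀`, whose mean dissipation
vanishes (`longTimeAvgSup_dissipation_eq_zero_of_zero_source`) — contradicting `ε > 0`. [folklore] -/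
theorem UniformRelaxationWitnessUnder.relaxingFamilyUnder
    {H : (𝕋² → E²) → (𝕋² → ℝ) → (ℕ → ℝ) → (ℕ → ℝ → 𝕋² → E²) → Prop}
    (hX : UniformRelaxationWitnessUnder H) : RelaxingFamilyUnder H := by
  obtain ⟨g, h, hg, hgd, hgm, hh, hhm, ν, v₀, v, hν, hνlim, hLH, hbd, hE, hH, hU, ε, hε, habs⟩ := hX
  refine ⟨g, h, hg, hgd, hgm, hh, hhm, ?_, ν, v₀, v, hν, hνlim, hLH, hbd, hE, hH, hU⟩
  rintro rfl
  obtain ⟨θ, hθ, hεle⟩ := habs 0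
  rw [longTimeAvgSup_dissipation_eq_zero_of_zero_source (hν 0) (hbd 0) hθ] at hεle
  exact absurd hεle (not_le.2 hε)

/-! ## Corollaries: the negative knowledge of `RelaxingFamily` binds the crux -/

/-- **A refutation of crux r3 kills r2**: `¬ RelaxingFamily → ¬ UniformRelaxationWitness`
(the profile of an X-witness is nonzero, so its (U_h) half is a `RelaxingFamily` witness). [folklore] -/
theorem uniformRelaxationWitness_false_of_not_relaxingFamily (hR : ¬ RelaxingFamily) :
    ¬ UniformRelaxationWitness := fun hX =>
  hR (uniformRelaxationWitnessUnder_true_iff.2 hX).relaxingFamilyUnder.relaxingFamily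

/-- **The degenerate profile is excluded**: no witness of X has `h = 0`. [folklore] -/
theorem uniformRelaxationWitness_false_with_zero_profile :
    ¬ UniformRelaxationWitnessUnder (fun _ h _ _ => h = 0) := fun hX => by
  obtain ⟨_, h, -, -, -, -, -, hh0, _, _, _, -, -, -, -, -, hH, -⟩ := hX.relaxingFamilyUnder
  exact hh0 hH

/-- **X is false without super-linear enstrophy growth** (Seis' floor, unconditional): no witness
of `UniformRelaxationWitness` admits a `j`-uniform linear windowed budget
`∫₀ᵗ ‖∇v_j(s_j + τ)‖_{L²} dτ ≤ M (1 + t)` (with essentially bounded energy) from some phase `s_j` on.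
[cite: Seis2022, Thm 2 and Remark 1 (arXiv:2003.08794 pp. 3–4)] -/
theorem uniformRelaxationWitness_false_without_superlinearEnstrophy :
    ¬ UniformRelaxationWitnessUnder LinearEnstrophyBudget := fun hX =>
  relaxingFamily_false_without_superlinearEnstrophy hX.relaxingFamilyUnder

/-- **X is false without unbounded enstrophy**: no witness of `UniformRelaxationWitness` has
`j`-uniformly (essentially) bounded enstrophy `‖∇v_j(s_j + t)‖²_{L²} ≤ Z` from some phase on — no
stirring, Galilean drifts, laminar and condensate states, `H¹`-convergent families are all excluded.
[cite: Seis2022, Thm 2 (arXiv:2003.08794 pp. 3–4)] -/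
theorem uniformRelaxationWitness_false_without_unboundedEnstrophy :
    ¬ UniformRelaxationWitnessUnder BoundedEnstrophy := fun hX =>
  relaxingFamily_false_without_unboundedEnstrophy hX.relaxingFamilyUnder

/-- **X is false without super-linear growth of the windowed MEAN enstrophy**: no witness of
`UniformRelaxationWitness` has `∫₀ᵗ ‖∇v_j(s_j + τ)‖²_{L²} dτ ≤ Z (1 + t)` with one `Z` from some phase
on — the receptacle of every `ν`-uniform time-averaged enstrophy bound (single-shell forcing:
`⟨‖∇v‖²⟩ ≤ 4π² m E` by the ShellPincer bound; band-limited Galerkin stirring). By the planar energy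
balance `ν_j⟨‖∇v_j‖²⟩ = ⟨⟨g, v_j⟩⟩ ≤ ‖g‖₂ E^{1/2}` only `Z_j ≲ ν_j^{-1}` (Alexakis–Doering: `ν_j^{-1/2}`)
is available in general, so this does not refute the crux: a kill is exactly a `ν`-uniform
`o(log²(1/ν))` windowed enstrophy bound for bounded-energy steadily forced planar Navier–Stokes.
[cite: Seis2022, Remark 1 (arXiv:2003.08794 p. 4)] -/
theorem uniformRelaxationWitness_false_without_superlinearMeanEnstrophy :
    ¬ UniformRelaxationWitnessUnder QuadraticEnstrophyBudget := fun hX =>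
  relaxingFamily_false_without_superlinearMeanEnstrophy hX.relaxingFamilyUnder

end Summit.AnomalousDissipation.AnomalousDissipation.Theorems.UniformRelaxationWitness.Negative

end
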